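import Literature.AnabelianGeometry.AbsoluteAnabelian.AbsTopIII.CuspidalCyclotome
import Literature.AnabelianGeometry.AbsoluteAnabelian.AbsTopIII.KummerIntrinsic
import Literature.AnabelianGeometry.AbsoluteAnabelian.AbsTopIII.KummerFaithfulFGExtensionProofs
import HarnessLib

/-!
# [AbsTopIII] Prop. 1.6 (i) at a model, from the Kummer-exactness law (proof-only companion)

Mochizuki, *Topics in Absolute Anabelian Geometry III*, §1, Prop. 1.6 (i) pp. 34–35 (manuscript pages,
lit key `paper:url-5493eb38cbb7`): "suppose further that `k` is a Kummer-faithful field [...] (i) The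
Kummer map `κ_U : Γ(U, 𝒪_U^×) → H¹(Π_U, M_X)` is injective."  The printed proof (p. 35): injectivity
"follows immediately from the Kummer-faithfulness" — i.e. from (a) a regular unit whose Kummer class
vanishes is an `N`-th power in `K_U^×` for every `N` (exactness of the Kummer sequence on `U_ét`), and
(b) `⋂_N (K_U^×)^N = {1}`, which holds because the function field `K_U` is a finitely generated
extension of the (torally) Kummer-faithful field `k` (Rmk. 1.5.4 (ii), `Rmk_1_5_4_ii_holds`).

The statements `Prop_1_6_i` (`CuspidalCyclotome.lean`, relative to `M : KummerCurveModel`) and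
`IntrinsicKummerModel.Prop_1_6_i` (`KummerIntrinsic.lean`) are predicates on an INTERFACE model whose
Kummer map is a free field; their universal closures are refuted in the tree
(`not_forall_prop_1_6_i_of_isKummerFaithful`, `IntrinsicKummerModel.forall_prop_1_6_i_iff`).  This
PROOF-ONLY file proves them AT EVERY MODEL SATISFYING THE TWO INTERFACE LAWS that a genuine
(étale-`π₁`) model satisfies — explicit hypotheses, no new `Prop` fact, no definition:

* (FG)  `K_U` is a finitely generated field extension of `k` (function field of a curve, §1 p. 29);
* (KUM) Kummer exactness: if `κ_U(f) = 1` then `f` is an `N`-th power in `K_U^×` for every `N ≥ 1`,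
  asked only in the situation of the statement (cyclotome presentation, resp. `X` proper scheme-like
  of genus `≥ 2`; `k` Kummer-faithful);

and records the converse (injectivity implies (KUM)), so that AT MODELS WITH (FG) Prop. 1.6 (i) is
EQUIVALENT to the Kummer-exactness law.  HONEST FRAMING: typed ≠ proved for genuine curves (no étale
`π₁` in the tree; the laws are binders); nothing here bears on [IUTchIII] Cor. 3.12.
-/

noncomputable section

open scoped Classical

namespace Literature.AnabelianGeometry.AbsoluteAnabelian.AbsTopIII

universe u v

/-! ### The algebraic core: Kummer exactness + `⋂_N (K^×)^N = 1` ⇒ injectivity -/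

/-- A homomorphism out of a subgroup `S ⊆ K^×` whose kernel consists of elements that are `N`-th
powers in `K^×` for every `N ≥ 1` is injective as soon as `⋂_N (K^×)^N = {1}`
(`DivisibleElementsTrivial K^×`, Def. 1.5 (a) for `𝔾_m`) — the algebraic core of the proof of
Prop. 1.6 (i), p. 35. [cite: MochizukiAbsTopIII2015, Prop 1.6 (i) p.35] -/
theorem injective_of_kummerExact {K : Type u} [Field K] (hK : DivisibleElementsTrivial Kˣ)
    {S : Subgroup Kˣ} {T : Type v} [Group T] (κ : S →* T)
    (hκ : ∀ f : S, κ f = 1 → ∀ N : ℕ, 0 < N → ∃ g : Kˣ, g ^ N = (f : Kˣ)) :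
    Function.Injective κ := by
  rw [injective_iff_map_eq_one]
  intro f hf
  have h1 : (f : Kˣ) = 1 := hK.eq_one_of_forall_exists_pow (f : Kˣ) (hκ f hf)
  exact Subtype.ext h1

/-- Conversely, an injective homomorphism out of `S ⊆ K^×` satisfies the Kummer-exactness clause
trivially (its kernel is `{1}`, and `1 = 1 ^ N`). [cite: MochizukiAbsTopIII2015, Prop 1.6 (i) p.35] -/
theorem kummerExact_of_injective {K : Type u} [Field K] {S : Subgroup Kˣ} {T : Type v} [Group T]
    (κ : S →* T) (hκ : Function.Injective κ) (f : S) (hf : κ f = 1) (N : ℕ) (_hN : 0 < N) :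
    ∃ g : Kˣ, g ^ N = (f : Kˣ) := by
  have h1 : f = 1 := hκ (by rw [hf, map_one])
  exact ⟨1, by rw [h1, one_pow]; rfl⟩

/-- The function field `K_U`, a finitely generated extension of a Kummer-faithful field `k`, satisfies
`⋂_N (K_U^×)^N = {1}`: `k` is torally Kummer-faithful (`IsKummerFaithful.isTorallyKummerFaithful`,
Rmk. 1.5.3 (ii)), hence so is `K_U` (Rmk. 1.5.4 (ii), `Rmk_1_5_4_ii_holds`), whose torus clause at the
trivial extension `K_U/K_U` is the claim. [cite: MochizukiAbsTopIII2015, Rmk 1.5.4 (ii) p.34] -/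
theorem divisibleElementsTrivial_units_of_fg_of_isKummerFaithful {k : Type u} [Field k]
    {K : Type u} [Field K] [Algebra k K] (hFG : (⊤ : IntermediateField k K).FG)
    (hk : IsKummerFaithful k) : DivisibleElementsTrivial Kˣ :=
  (Rmk_1_5_4_ii_holds k K hFG hk.isTorallyKummerFaithful).units K (Module.Finite.self K)

/-! ### Prop. 1.6 (i) relative to `M : KummerCurveModel` (cyclotome realised extrinsically) -/

namespace KummerCurveModel

variable (M : KummerCurveModel.{u})

/-- **Prop. 1.6 (i) at every model `M : KummerCurveModel` satisfying the interface laws (FG) and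
(KUM)** — the printed proof p. 35: `κ_U(f₁) = κ_U(f₂)` ⇒ `f₁/f₂ ∈ ⋂_N (K_U^×)^N` (law (KUM):
`κ_U(f) = 1 ⇒ f ∈ (K_U^×)^N ∀ N`, asked only at cyclotome presentations over a Kummer-faithful `k`)
`= {1}` (law (FG): `K_U ⊇ k` finitely generated; Rmk. 1.5.4 (ii) BY NAME).  Hypotheses (FG), (KUM)
are interface laws of a genuine model, carried as binders.
[cite: MochizukiAbsTopIII2015, Prop 1.6 (i) p.35] -/
theorem prop_1_6_i_of_kummerExact
    (hFG : ∀ U : M.Curve, (⊤ : IntermediateField (M.base U) (M.FunctionField U)).FG)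
    (hKum : ∀ (U Ux X : M.Curve) (h₁ : M.IsCofiniteOpen U Ux) (h₂ : M.IsCofiniteOpen Ux X)
      (x : (M.cusps Ux).Cusp), M.IsScheme U → M.IsCyclotomePresentation h₂ x →
      IsKummerFaithful (M.base U) →
      ∀ f : M.regularUnits U, M.kummer h₁ h₂ f = 1 →
        ∀ N : ℕ, 0 < N → ∃ g : (M.FunctionField U)ˣ, g ^ N = (f : (M.FunctionField U)ˣ)) :
    Literature.AnabelianGeometry.AbsoluteAnabelian.AbsTopIII.Prop_1_6_i M := by
  intro U Ux X h₁ h₂ x hU hpres hk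
  exact injective_of_kummerExact (divisibleElementsTrivial_units_of_fg_of_isKummerFaithful (hFG U) hk)
    (M.kummer h₁ h₂) (hKum U Ux X h₁ h₂ x hU hpres hk)

/-- Conversely, Prop. 1.6 (i) for `M` implies the law (KUM) for `M` (an injective `κ_U` has trivial
kernel). [cite: MochizukiAbsTopIII2015, Prop 1.6 (i) p.35] -/
theorem kummerExact_of_prop_1_6_i
    (h : Literature.AnabelianGeometry.AbsoluteAnabelian.AbsTopIII.Prop_1_6_i M)
    (U Ux X : M.Curve) (h₁ : M.IsCofiniteOpen U Ux) (h₂ : M.IsCofiniteOpen Ux X)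
    (x : (M.cusps Ux).Cusp) (hU : M.IsScheme U) (hpres : M.IsCyclotomePresentation h₂ x)
    (hk : IsKummerFaithful (M.base U)) (f : M.regularUnits U) (hf : M.kummer h₁ h₂ f = 1)
    (N : ℕ) (hN : 0 < N) : ∃ g : (M.FunctionField U)ˣ, g ^ N = (f : (M.FunctionField U)ˣ) :=
  kummerExact_of_injective (M.kummer h₁ h₂) (h U Ux X h₁ h₂ x hU hpres hk) f hf N hN

/-- **Prop. 1.6 (i) ⟺ Kummer exactness**, at every model `M : KummerCurveModel` with finitely
generated function fields (law (FG)). [cite: MochizukiAbsTopIII2015, Prop 1.6 (i) p.35] -/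
theorem prop_1_6_i_iff_kummerExact
    (hFG : ∀ U : M.Curve, (⊤ : IntermediateField (M.base U) (M.FunctionField U)).FG) :
    Literature.AnabelianGeometry.AbsoluteAnabelian.AbsTopIII.Prop_1_6_i M ↔
      ∀ (U Ux X : M.Curve) (h₁ : M.IsCofiniteOpen U Ux) (h₂ : M.IsCofiniteOpen Ux X)
        (x : (M.cusps Ux).Cusp), M.IsScheme U → M.IsCyclotomePresentation h₂ x →
        IsKummerFaithful (M.base U) →
        ∀ f : M.regularUnits U, M.kummer h₁ h₂ f = 1 →
          ∀ N : ℕ, 0 < N → ∃ g : (M.FunctionField U)ˣ, g ^ N = (f : (M.FunctionField U)ˣ) :=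
  ⟨fun h U Ux X h₁ h₂ x hU hpres hk f hf N hN =>
      M.kummerExact_of_prop_1_6_i h U Ux X h₁ h₂ x hU hpres hk f hf N hN,
    M.prop_1_6_i_of_kummerExact hFG⟩

end KummerCurveModel

/-! ### Prop. 1.6 (i) relative to `M : IntrinsicKummerModel` (intrinsic cyclotome `M_X(Ẑ)`) -/

namespace IntrinsicKummerModel

variable (M : IntrinsicKummerModel.{u})

/-- **`IntrinsicKummerModel.Prop_1_6_i` at every model satisfying (FG) and (KUM)** (intrinsic
version: `U ⊆ X` cofinite open, `X` proper scheme-like of genus `≥ 2`, `k` Kummer-faithful; printed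
proof p. 35 as above, Rmk. 1.5.4 (ii) BY NAME). [cite: MochizukiAbsTopIII2015, Prop 1.6 (i) p.35] -/
theorem prop_1_6_i_of_kummerExact
    (hFG : ∀ U : M.Curve, (⊤ : IntermediateField (M.base U) (M.FunctionField U)).FG)
    (hKum : ∀ (U X : M.Curve) (h : M.IsCofiniteOpen U X) (hX : M.IsProper X), M.IsScheme U →
      M.IsScheme X → 2 ≤ M.genus X → IsKummerFaithful (M.base U) →
      ∀ f : M.regularUnits U, M.kummerMap h hX f = 1 →
        ∀ N : ℕ, 0 < N → ∃ g : (M.FunctionField U)ˣ, g ^ N = (f : (M.FunctionField U)ˣ)) :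
    M.Prop_1_6_i := by
  intro U X h hX hU hXs hg hk
  exact injective_of_kummerExact (divisibleElementsTrivial_units_of_fg_of_isKummerFaithful (hFG U) hk)
    (M.kummerMap h hX) (hKum U X h hX hU hXs hg hk)

/-- Conversely `Prop_1_6_i` for `M` implies (KUM) for `M`. [cite: MochizukiAbsTopIII2015, Prop 1.6 (i) p.35] -/
theorem kummerExact_of_prop_1_6_i (h : M.Prop_1_6_i) (U X : M.Curve) (h' : M.IsCofiniteOpen U X)
    (hX : M.IsProper X) (hU : M.IsScheme U) (hXs : M.IsScheme X) (hg : 2 ≤ M.genus X)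
    (hk : IsKummerFaithful (M.base U)) (f : M.regularUnits U) (hf : M.kummerMap h' hX f = 1)
    (N : ℕ) (hN : 0 < N) : ∃ g : (M.FunctionField U)ˣ, g ^ N = (f : (M.FunctionField U)ˣ) :=
  kummerExact_of_injective (M.kummerMap h' hX) (h U X h' hX hU hXs hg hk) f hf N hN

/-- **`Prop_1_6_i ⟺ Kummer exactness`** at every intrinsic model with finitely generated function
fields (law (FG)). [cite: MochizukiAbsTopIII2015, Prop 1.6 (i) p.35] -/
theorem prop_1_6_i_iff_kummerExact
    (hFG : ∀ U : M.Curve, (⊤ : IntermediateField (M.base U) (M.FunctionField U)).FG) :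
    M.Prop_1_6_i ↔
      ∀ (U X : M.Curve) (h : M.IsCofiniteOpen U X) (hX : M.IsProper X), M.IsScheme U →
        M.IsScheme X → 2 ≤ M.genus X → IsKummerFaithful (M.base U) →
        ∀ f : M.regularUnits U, M.kummerMap h hX f = 1 →
          ∀ N : ℕ, 0 < N → ∃ g : (M.FunctionField U)ˣ, g ^ N = (f : (M.FunctionField U)ˣ) :=
  ⟨fun h U X h' hX hU hXs hg hk f hf N hN => M.kummerExact_of_prop_1_6_i h U X h' hX hU hXs hg hk f hf N hN,
    M.prop_1_6_i_of_kummerExact hFG⟩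

end IntrinsicKummerModel

end Literature.AnabelianGeometry.AbsoluteAnabelian.AbsTopIII
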